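import Summits.MatrixMultiplication.OmegaCensus.STPPSmallPatternKernelSearchStab
import Summits.MatrixMultiplication.OmegaCensus.STPPSmallPatternKernelProduct

/-!
# ω-census, `(2,1,1)^6` is infeasible in `ℤ/3 × ℤ/3 × ℤ/3` — kernel search (stabiliser normal form), part 6 of 10

HONEST FRAMING (pub-omega census; verbatim): lottery ticket; floor = certified bounds/negative ranges.
Census STRUCTURE bookkeeping of the STPP track (seat pub-omega-eng2 = ENG2, gen 34, on the kernel engine of seat pub-omega-stpp-3 gen 23
with the stabiliser normal form / global mask of `STPPSmallPatternKernelSearchStab.lean`; STRUCTURE row B5, the threshold column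
`T1(H) = max {k : (2,1,1)^k ⊆ H}`, lower side of the `k = 6` ORDER LAW `(2,1,1)⁶ ⊆ G ↔ 30 ≤ |G|`), not progress on `ω`: small patterns
in small groups bound no exponent.

Chunks of the kernel mask search `STPP211Neg.search3 (prodGC 3 (prodGC 3 (zcode 3))) 6` (`decide +kernel`; ≈ 136 s of kernel time predicted); assembled in
`STPPSmallPatternNone211K6P3x3x3.lean`.  Chunk entries `(d, x1, x2, x3, xg)`: representative `d` of `A₀ = {0, d}`, exclusion masks of the first three levels, global
exclusion mask (`STPPSmallPatternKernelSearchStab.lean`).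

References: H. Cohn, R. Kleinberg, B. Szegedy, C. Umans, FOCS 2005 (arXiv:math/0511460), Def. 5.1.  Record: pub-omega HOME
`pub-omega-eng2-g34/` (ENG2's C mirror `k211g.c` of the kernel tree with the level-1 and global exclusion masks — `k211c.c` of gen 33
validated to the translation count against stpp-3's `k211v3.py` — gives COMPLETE NONE on this cell with 8715262 mask translations over the
canonical first levels; planner `plan3.py`; farm calibration 161 µs per translation; not used by the proofs).
-/

set_option Elab.async false  -- several kernel pieces: elaborate sequentially (memory)

namespace Summit.MatrixMultiplication.OmegaCensus

namespace STPP211Neg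

/-- Chunk list 10 of `ℤ/3 × ℤ/3 × ℤ/3`, `k = 6` (555129 mask translations in the mirror ≈ 89 s predicted). -/
def P3_3_3k6.ch10 : List (ℕ × ℕ × ℕ × ℕ × ℕ) :=
  [(1, 134217719, 134217711, 134088703, 7)]

/-- Kernel search over chunk list 10 of `ℤ/3 × ℤ/3 × ℤ/3`, `k = 6`. -/
theorem P3_3_3k6.s10 : search3 (prodGC 3 (prodGC 3 (zcode 3))) 6 P3_3_3k6.ch10 = true := by
  decide +kernel

/-- Chunk list 11 of `ℤ/3 × ℤ/3 × ℤ/3`, `k = 6` (289645 mask translations in the mirror ≈ 47 s predicted). -/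
def P3_3_3k6.ch11 : List (ℕ × ℕ × ℕ × ℕ × ℕ) :=
  [(1, 134217719, 134217711, 131071, 7)]

/-- Kernel search over chunk list 11 of `ℤ/3 × ℤ/3 × ℤ/3`, `k = 6`. -/
theorem P3_3_3k6.s11 : search3 (prodGC 3 (prodGC 3 (zcode 3))) 6 P3_3_3k6.ch11 = true := by
  decide +kernel

/-- The chunk lists of this part, concatenated. -/
def P3_3_3k6.part6 : List (ℕ × ℕ × ℕ × ℕ × ℕ) :=
  P3_3_3k6.ch10 ++ P3_3_3k6.ch11

/-- The kernel search over this part's chunks (assembled). -/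
theorem P3_3_3k6.ps6 : search3 (prodGC 3 (prodGC 3 (zcode 3))) 6 P3_3_3k6.part6 = true := by
  simp only [P3_3_3k6.part6, search3_append, P3_3_3k6.s10, P3_3_3k6.s11, Bool.and_self]

end STPP211Neg

end Summit.MatrixMultiplication.OmegaCensus
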